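import Literature.NumberTheory.EllipticCurves.NeronOggShafarevichLocalProofs
import Literature.NumberTheory.EllipticCurves.KodairaNeronUnramifiedInertiaProofs
import Literature.NumberTheory.EllipticCurves.HasseWeilGoodReductionProofs
import Literature.NumberTheory.EllipticCurves.TateModuleProjSurjectiveProofs
import Literature.NumberTheory.EllipticCurves.SigmaEulerData
import Literature.NumberTheory.GaloisRepresentations.DecompositionGroupOfCompletion
import Literature.NumberTheory.Automorphic.AdicCompletionResidueCard
import Mathlib.LinearAlgebra.Charpoly.Basic
import HarnessLib

/-!
# `E[p^∞]` at a finite place `w ∤ p`: trivial inertia forces good reduction (Néron–Ogg–Shafarevich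
# (d) ⇒ (a) in `localMap` currency) and a Frobenius lift satisfies `ρ(g)² = a_w ρ(g) − q_w` on
# `E[p^∞]` (Cayley–Hamilton on `T_p E`)

Topic `NumberTheory/EllipticCurves`; namespace `WeierstrassCurve` (dot-notation on the curve, as in
the sibling files `NeronOggShafarevichLocal`, `HasseWeilGoodReductionFrobenius`,
`BigGaloisRepLocalInputs`).  THEOREMS ONLY (no definition, no named fact, no instance; D-0026).
Written for the discharge of the named fact
`Castella2018.selmerBig_eq_selmerBigDecomp_of_unramifiedOutside`
(`Castella2018/SigmaSelmerUnramifiedOutsideS.lean`; plan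
`pub/bsd-cited/sheets/NOTE-r17-SigmaBridge-discharge-plan-df9ef7a3.md`, module M3): the two
ARITHMETIC inputs about `E[p^∞] = PrimaryTorsion (geomPoints E) p` at a finite place `w ∤ p` of a
number field `K` that the vanishing `ℋ^ur_w(T_pE ⊗ Λ^*) = 0` (Castella 2018 §2.2) consumes.

* §1 **(NOS, (d) ⇒ (a), in the currency of the fact's hypothesis `hram`)**
  `hasGoodReductionAt_of_primaryTorsionGaloisRep_localMap_inr_eq`: if the local inertia group
  `I_{K_w} = absInertia K_w ⊂ Γ_{K_w} → Γ_K` (`BigGaloisRep.localMap K (Sum.inr w)`) acts trivially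
  on `E[p^∞]` (`W.primaryTorsionGaloisRep p`), then `E` has good reduction at `w`.  This is
  Silverman, *AEC*, Thm. VII.7.1 (d) ⇒ (a) with `m` ranging over the powers `pⁿ` — the tree's
  DISCHARGED local torsion form `hasGoodReductionAt_of_infinite_unramifiedTorsion_holds`
  (`NeronOggShafarevichLocalProofs`) — moved from the ideal-theoretic inertia group `I_𝔐 ≤ Γ_{K_w}`
  acting on `E(K̄_w)[pⁿ]` to `absInertia K_w` acting through the chosen restriction
  `absGaloisRestrict K K_w` on `E(K̄)[pⁿ]` by the tree's `inertia_eq_absInertia` (Neukirch II (9.3)),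
  `exists_pointsMapOfEmb_eq_of_nsmul_eq_zero` (all `pⁿ`-torsion is algebraic, Cor. III.6.4(b)),
  `pointsMapOfEmb_smul` and `resGalOfEmb_eq_of_apply_eq` / `absGaloisRestrict_apply_smul` (the chosen
  restriction IS `res_ι` for the chosen embedding) — the route of the converse transport VII.4.1(b)
  ⇒ (unr) used by the erratum road, reversed.
* §0/§2 **(the integers `q_w`, `a_w`)**
  `HeightOneSpectrum.two_le_natCard_residueField_adicCompletionIntegers` (`q_w = #k_w ≥ 2`, hence
  `≠ ±1`) and `frobeniusTraceAt_ne_natCard_add_one` (`a_w ≠ q_w + 1`, because `#Ẽ_w(k_w) ≥ 1`: the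
  tree's `residueCard_sub_frobeniusTraceAt_add_one_ne_zero`, `SigmaEulerData`).
* §3 **(Cayley–Hamilton on `E[p^∞]`)** `smul_smul_eq_of_isArithFrobAt`: at a place `w ∤ p` of good
  reduction, every arithmetic Frobenius `σ ∈ Γ_K` at a prime `𝔓 ∣ w` satisfies
  `σσP = a_w·σP − q_w·P` for every `P ∈ E(K̄)[pⁿ]` — `det(X − σ | T_pE) = X² − a_w X + q_w` (the
  tree's `charpoly_galoisRepTate_of_hasGoodReductionAt` fed with the DISCHARGED trace and
  determinant facts `trace_/det_galoisRepTate_frobenius_of_hasGoodReductionAt_holds`), Mathlib's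
  Cayley–Hamilton `LinearMap.aeval_self_charpoly`, and the equivariant surjection `T_pE → E[pⁿ]`
  (`proj_surjective_of_isAlgClosed_holds`, `TateModule.proj_smul_of_distribMulAction`); then
  `primaryTorsionGaloisRep_sq_eq_of_isArithFrobAt` on `E[p^∞]`, and
  **`primaryTorsionGaloisRep_sq_eq_of_isFrobPow`**: the same for `g = absGaloisRestrict K K_w φ`,
  `φ ∈ Γ_{K_w}` any arithmetic Frobenius lift (`IsFrobPow φ 1`; local ↔ global Frobenius by the
  tree's `isArithFrobAt_absGaloisRestrict_adicCompletionPrime_iff` at `𝔓₀ = adicCompletionPrime K w`).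
  This is exactly the hypothesis `hCH` of `BigRepModule.bigRep_sub_self_surjective`
  (`BigRepModuleFrobeniusSurjectiveProofs`, module M2) for `A = E[p^∞]`.

References: [SilvermanAEC2009] Thm. VII.7.1, Prop. VII.4.1(b), III.§7, C.§16 and C.21 Remark 21.3
(`det(X − ρ(φ_v)) = X² − a_v X + q_v`); [NeukirchANT1999] Ch. II §9 (9.3), (9.6);
[Castella2018] §2.2 (the two `ℋ^ur` sentences) and Thm. 2.6 ("assume that `Σ ∪ S_p` contains all
places of `K` at which `T` is ramified") — where these inputs are used.
-/

noncomputable section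

open scoped Classical
open Polynomial Field NumberField IsDedekindDomain IsDedekindDomain.HeightOneSpectrum
open Literature.NumberTheory.EllipticCurves Literature.NumberTheory.EllipticCurves.BigGaloisRep
open Literature.NumberTheory.GaloisRepresentations Literature.NumberTheory.Automorphic
open Literature.NumberTheory.GaloisRepresentations.IsNonarchimedeanLocalField

universe u

/-! ### §0. The residue cardinality `q_w = #k_w ≥ 2` -/

namespace IsDedekindDomain.HeightOneSpectrum

variable {K : Type u} [Field K] [NumberField K] (w : HeightOneSpectrum (𝓞 K))

/-- `q_w = #k_w ≥ 2`: the residue field of `𝒪_w` is `𝓞 K ⧸ w`, a finite field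
(`WeierstrassCurve.natCard_residueField_eq_residueCard`, `one_lt_residueCard`); "`q_v = #k_v` the
norm of the prime ideal corresponding to `v`". [cite: SilvermanAEC2009, C.§16 (q_v = #k_v, the norm of v)] -/
theorem two_le_natCard_residueField_adicCompletionIntegers :
    2 ≤ Nat.card (IsLocalRing.ResidueField (w.adicCompletionIntegers K)) := by
  rw [WeierstrassCurve.natCard_residueField_eq_residueCard]
  exact w.one_lt_residueCard

/-- `q_w ≠ 1` (as an integer; `q_v = #k_v ≥ 2`). [cite: SilvermanAEC2009, C.§16 (q_v = #k_v, the norm of v)] -/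
theorem natCard_residueField_adicCompletionIntegers_ne_one :
    (Nat.card (IsLocalRing.ResidueField (w.adicCompletionIntegers K)) : ℤ) ≠ 1 := by
  have h := w.two_le_natCard_residueField_adicCompletionIntegers
  omega

/-- `q_w ≠ −1` (as an integer; `q_v = #k_v ≥ 2`). [cite: SilvermanAEC2009, C.§16 (q_v = #k_v, the norm of v)] -/
theorem natCard_residueField_adicCompletionIntegers_ne_neg_one :
    (Nat.card (IsLocalRing.ResidueField (w.adicCompletionIntegers K)) : ℤ) ≠ -1 := by
  have h := w.two_le_natCard_residueField_adicCompletionIntegers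
  omega

end IsDedekindDomain.HeightOneSpectrum

namespace WeierstrassCurve

variable {K : Type u} [Field K] [NumberField K] (W : WeierstrassCurve K) [W.IsElliptic]
  (p : ℕ) [Fact p.Prime]

/-! ### §1. Trivial local inertia on `E[p^∞]` forces good reduction (NOS (d) ⇒ (a)) -/

section NOS

omit [W.IsElliptic] in
/-- The fact's hypothesis `hram` ("`I_w` acts trivially on `E[p^∞]` through
`localMap K (Sum.inr w)`"), unfolded to points: every `σ ∈ absInertia K_w`, restricted to `Γ_K`
along the chosen embedding, fixes every `P ∈ E(K̄)` with `pⁿ P = O`.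
[cite: SilvermanAEC2009, VII.§4 (Definition: "unramified at v if the action of I_v on it is trivial")] -/
theorem smul_eq_of_primaryTorsionGaloisRep_localMap_inr_eq {w : HeightOneSpectrum (𝓞 K)}
    (hram : ∀ (σ : LocalGroup K (Sum.inr w)) (P : PrimaryTorsion (geomPoints W) p),
      W.primaryTorsionGaloisRep p (localMap K (Sum.inr w) σ) P = P)
    {σ : absoluteGaloisGroup (w.adicCompletion K)} (hσ : σ ∈ absInertia (w.adicCompletion K))
    {P : geomPoints W} {n : ℕ} (hP : p ^ n • P = 0) :
    absGaloisRestrict K (w.adicCompletion K) σ • P = P := by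
  have h := congrArg PrimaryTorsion.val
    (hram (⟨σ, hσ⟩ : ↥(absInertia (w.adicCompletion K))) (PrimaryTorsion.mk P n hP))
  rwa [val_primaryTorsionGaloisRep_apply, PrimaryTorsion.val_mk] at h

omit [NumberField K] [W.IsElliptic] in
/-- The chosen restriction IS `res_ι` for the chosen embedding: `resGalOfEmb (absClosureEmbedding K L)
= absGaloisRestrict K L` (both are characterised by `ι (τ • x) = σ • ι x`; the tree's
`resGalOfEmb_eq_of_apply_eq` and `absGaloisRestrict_apply_smul`).  Same statement as the Summits-side
`Summit.….X11b.BigRep.resGalOfEmb_absClosureEmbedding_eq` (`ErratumRoadFiveBigRepArithInputs`), put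
in `Literature` (which cannot import `Summits`) for the reverse transport below.
[cite: MilneFT2022, Ch. 7 (restriction to the absolute Galois group of a subfield, well defined by the embedding)] -/
theorem resGalOfEmb_absClosureEmbedding (L : Type u) [Field L] [Algebra K L]
    (σ : absoluteGaloisGroup L) :
    resGalOfEmb (absClosureEmbedding K L) σ = absGaloisRestrict K L σ :=
  resGalOfEmb_eq_of_apply_eq (absClosureEmbedding K L) fun x ↦ absGaloisRestrict_apply_smul K L σ x

/-- **Néron–Ogg–Shafarevich, (d) ⇒ (a), in `localMap` currency.**  For an elliptic curve `E` over
a number field `K`, a prime `p` and a finite place `w ∤ p`: if the local inertia group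
`I_{K_w} = absInertia K_w`, mapped to `Γ_K` by `localMap K (Sum.inr w)` (= `absGaloisRestrict K K_w`
on `absInertia K_w`), acts trivially on `E[p^∞] = PrimaryTorsion (geomPoints E) p`, then `E` has
good reduction at `w`.  Proof: the powers `pⁿ` are infinitely many integers prime to `w`, and for
each of them `E(K̄_w)[pⁿ]` is fixed by `I_𝔐 = absInertia K_w` (`inertia_eq_absInertia`): a
`pⁿ`-torsion point of `E(K̄_w)` is `ι_* P` with `P ∈ E(K̄)[pⁿ]`
(`exists_pointsMapOfEmb_eq_of_nsmul_eq_zero`) and `σ (ι_* P) = ι_* (res σ • P) = ι_* P`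
(`pointsMapOfEmb_smul`); so the tree's discharged Thm. VII.7.1 (d) ⇒ (a)
(`hasGoodReductionAt_of_infinite_unramifiedTorsion_holds`) applies.
[cite: SilvermanAEC2009, Thm. VII.7.1 ((d) ⇒ (a))] [cite: NeukirchANT1999, Ch. II §9 Prop. (9.6)] -/
theorem hasGoodReductionAt_of_primaryTorsionGaloisRep_localMap_inr_eq {w : HeightOneSpectrum (𝓞 K)}
    (hpw : ((p : ℕ) : 𝓞 K) ∉ w.asIdeal)
    (hram : ∀ (σ : LocalGroup K (Sum.inr w)) (P : PrimaryTorsion (geomPoints W) p),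
      W.primaryTorsionGaloisRep p (localMap K (Sum.inr w) σ) P = P) :
    W.HasGoodReductionAt w := by
  obtain ⟨𝔐, h𝔐⟩ := w.localPrimesAbove_nonempty
  obtain ⟨val, hval⟩ := w.exists_spectralValuation
  refine W.hasGoodReductionAt_of_infinite_unramifiedTorsion_holds w h𝔐
    ((Set.infinite_range_of_injective
      (Nat.pow_right_injective (Fact.out : p.Prime).two_le)).mono ?_)
  rintro _ ⟨n, rfl⟩
  refine ⟨w.natCast_pow_not_mem hpw n, fun σ hσ Q hQ ↦ ?_⟩
  have hσ' : σ ∈ absInertia (w.adicCompletion K) := by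
    rwa [HeightOneSpectrum.inertia_eq_absInertia hval h𝔐] at hσ
  obtain ⟨P, hP, rfl⟩ := exists_pointsMapOfEmb_eq_of_nsmul_eq_zero W
    (absClosureEmbedding K (w.adicCompletion K)) (pow_ne_zero n (Fact.out : p.Prime).ne_zero) hQ
  rw [← pointsMapOfEmb_smul, resGalOfEmb_absClosureEmbedding,
    W.smul_eq_of_primaryTorsionGaloisRep_localMap_inr_eq p hram hσ' hP]

end NOS

/-! ### §2. The integer `a_w ≠ q_w + 1` -/

section Integers

variable (w : HeightOneSpectrum (𝓞 K))

omit [W.IsElliptic] in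
/-- **`a_w ≠ q_w + 1`**: `a_w = q_w + 1 − #Ẽ_w(k_w)` (`frobeniusTraceAt_def`) and `#Ẽ_w(k_w) ≥ 1`
(the tree's `residueCard_sub_frobeniusTraceAt_add_one_ne_zero`, `SigmaEulerData`), restated with
`q_w = Nat.card k_w` as it appears in `charpoly_galoisRepTate_of_hasGoodReductionAt`.  (At a good
place this says `#Ẽ_w(k_w) ≠ 0`, i.e. `det(1 − Frob_w | T_pE) ≠ 0`: the integer whose non-vanishing
makes `Frob_w − 1` surjective on `T_pE ⊗ Λ^*`.) [cite: SilvermanAEC2009, C.§16 (a_v = q_v + 1 − #Ẽ_v(k_v))] -/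
theorem frobeniusTraceAt_ne_natCard_add_one :
    W.frobeniusTraceAt w ≠
      (Nat.card (IsLocalRing.ResidueField (w.adicCompletionIntegers K)) : ℤ) + 1 := by
  have h := W.residueCard_sub_frobeniusTraceAt_add_one_ne_zero w
  rw [natCard_residueField_eq_residueCard]
  omega

end Integers

/-! ### §3. Cayley–Hamilton for a Frobenius on `E[pⁿ]` and on `E[p^∞]` -/

section CayleyHamilton

variable {W p}

/-- **`σσP = a_w·σP − q_w·P` on `E(K̄)[pⁿ]`** for an arithmetic Frobenius `σ ∈ Γ_K` at a prime
`𝔓 ∣ w`, `w ∤ p` a place of good reduction: the characteristic polynomial of `σ` on the free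
rank-two `ℤ_p`-module `T_pE` is `X² − a_w X + q_w` (`charpoly_galoisRepTate_of_hasGoodReductionAt`
with the discharged `trace_/det_galoisRepTate_frobenius_of_hasGoodReductionAt_holds`), so
`σ² − a_w σ + q_w = 0` on `T_pE` (Cayley–Hamilton, Mathlib `LinearMap.aeval_self_charpoly`), and
`T_pE → E[pⁿ]` is onto and `Γ_K`-equivariant (`proj_surjective_of_isAlgClosed_holds`,
`TateModule.proj_smul_of_distribMulAction`).
[cite: SilvermanAEC2009, C.21 Remark 21.3 (the characteristic polynomial of ρ(φ_v) is X² − a_v X + q_v) with III.§7] -/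
theorem smul_smul_eq_of_isArithFrobAt {w : HeightOneSpectrum (𝓞 K)} (hpw : ((p : ℕ) : 𝓞 K) ∉ w.asIdeal)
    (hv : W.HasGoodReductionAt w) {𝔓 : Ideal (absIntegers (𝓞 K) K)} (h𝔓 : 𝔓 ∈ w.primesAbove)
    {σ : absoluteGaloisGroup K} (hσ : IsArithFrobAt (𝓞 K) σ 𝔓)
    {P : geomPoints W} {n : ℕ} (hP : p ^ n • P = 0) :
    σ • σ • P =
      W.frobeniusTraceAt w • σ • P -
        (Nat.card (IsLocalRing.ResidueField (w.adicCompletionIntegers K)) : ℤ) • P := by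
  haveI := module_free_tateModule_holds W p
  haveI := module_finite_tateModule_holds W p
  -- Cayley–Hamilton on `T_pE`
  have hch := charpoly_galoisRepTate_of_hasGoodReductionAt
    (W.trace_galoisRepTate_frobenius_of_hasGoodReductionAt_holds p)
    (W.det_galoisRepTate_frobenius_of_hasGoodReductionAt_holds p) hpw hv h𝔓 hσ
  have hCH := LinearMap.aeval_self_charpoly (W.galoisRepTate p σ)
  rw [hch] at hCH
  -- lift `P` to `T_pE`
  obtain ⟨x, rfl⟩ := W.proj_surjective_of_isAlgClosed_holds p n (P := P)
    ((Submodule.mem_torsionBy_iff _ _).mpr (by rw [natCast_zsmul, hP]))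
  have hx := congrArg (fun f : Module.End ℤ_[p] (W.tateModule p) ↦ TateModule.proj p n (f x)) hCH
  simp only [map_add, map_sub, map_mul, aeval_X, aeval_C, Algebra.algebraMap_eq_smul_one,
    LinearMap.add_apply, LinearMap.sub_apply, Module.End.mul_apply, LinearMap.smul_apply,
    Module.End.one_apply, pow_two, LinearMap.zero_apply, map_zero, galoisRepTate_apply_apply] at hx
  -- `hx : proj (σ • σ • x) - proj ((a : ℤ_[p]) • σ • x) + proj ((q : ℤ_[p]) • x) = 0`
  rw [Int.cast_smul_eq_zsmul ℤ_[p], Nat.cast_smul_eq_nsmul ℤ_[p], map_zsmul, map_nsmul] at hx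
  simp only [TateModule.proj_smul_of_distribMulAction] at hx
  rw [← natCast_zsmul] at hx
  -- rearrange `u - v + t = 0` into `u = v - t`
  rw [← sub_eq_zero, ← hx]
  abel

/-- **`ρ(σ)² y = a_w ρ(σ) y − q_w y` on `E[p^∞]`** for an arithmetic Frobenius `σ ∈ Γ_K` at `𝔓 ∣ w`,
`w ∤ p` good (`smul_smul_eq_of_isArithFrobAt` on the underlying `p`-power torsion point).
[cite: SilvermanAEC2009, C.21 Remark 21.3 with III.§7] -/
theorem primaryTorsionGaloisRep_sq_eq_of_isArithFrobAt {w : HeightOneSpectrum (𝓞 K)}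
    (hpw : ((p : ℕ) : 𝓞 K) ∉ w.asIdeal) (hv : W.HasGoodReductionAt w)
    {𝔓 : Ideal (absIntegers (𝓞 K) K)} (h𝔓 : 𝔓 ∈ w.primesAbove)
    {σ : absoluteGaloisGroup K} (hσ : IsArithFrobAt (𝓞 K) σ 𝔓)
    (y : PrimaryTorsion (geomPoints W) p) :
    W.primaryTorsionGaloisRep p σ (W.primaryTorsionGaloisRep p σ y) =
      W.frobeniusTraceAt w • W.primaryTorsionGaloisRep p σ y -
        (Nat.card (IsLocalRing.ResidueField (w.adicCompletionIntegers K)) : ℤ) • y := by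
  obtain ⟨k, hk⟩ := y.exists_pow_smul_eq_zero
  refine PrimaryTorsion.ext ?_
  have e1 : ∀ z : PrimaryTorsion (geomPoints W) p,
      ((W.primaryTorsionGaloisRep p σ z : PrimaryTorsion (geomPoints W) p) : geomPoints W) =
        σ • (z : geomPoints W) := fun z ↦ rfl
  have e2 : ∀ (z z' : PrimaryTorsion (geomPoints W) p),
      ((z - z' : PrimaryTorsion (geomPoints W) p) : geomPoints W) = (z : geomPoints W) - z' :=
    fun _ _ ↦ rfl
  have e3 : ∀ (m : ℤ) (z : PrimaryTorsion (geomPoints W) p),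
      ((m • z : PrimaryTorsion (geomPoints W) p) : geomPoints W) = m • (z : geomPoints W) :=
    fun _ _ ↦ rfl
  rw [e1, e1, e2, e3, e3, e1]
  exact smul_smul_eq_of_isArithFrobAt hpw hv h𝔓 hσ hk

/-- **Local form: `ρ(g)² y = a_w ρ(g) y − q_w y` on `E[p^∞]` for `g = res φ`, `φ ∈ Γ_{K_w}` ANY
arithmetic Frobenius lift** (`IsFrobPow φ 1`), at a place `w ∤ p` of good reduction: `res φ` is an
arithmetic Frobenius at the prime `𝔓₀ = adicCompletionPrime K w` of `\bar ℤ_K` cut out by the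
completion (`isArithFrobAt_absGaloisRestrict_adicCompletionPrime_iff`, Neukirch II (9.6), with
`isFrobPow_one_iff_isAbsArithFrob_holds` and `residueFieldCard_adicCompletion_eq`), and
`𝔓₀ ∣ w` (`adicCompletionPrime_mem_primesAbove`).  This is the hypothesis `hCH` of
`BigRepModule.bigRep_sub_self_surjective` for `A = E[p^∞]`, `t = a_w`, `q = q_w`.
[cite: SilvermanAEC2009, C.21 Remark 21.3 with III.§7] [cite: NeukirchANT1999, Ch. II §9 Prop. (9.6)] -/
theorem primaryTorsionGaloisRep_sq_eq_of_isFrobPow {w : HeightOneSpectrum (𝓞 K)}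
    (hpw : ((p : ℕ) : 𝓞 K) ∉ w.asIdeal) (hv : W.HasGoodReductionAt w)
    {φ : absoluteGaloisGroup (w.adicCompletion K)} (hφ : IsFrobPow φ 1)
    (y : PrimaryTorsion (geomPoints W) p) :
    W.primaryTorsionGaloisRep p (absGaloisRestrict K (w.adicCompletion K) φ)
        (W.primaryTorsionGaloisRep p (absGaloisRestrict K (w.adicCompletion K) φ) y) =
      W.frobeniusTraceAt w •
          W.primaryTorsionGaloisRep p (absGaloisRestrict K (w.adicCompletion K) φ) y -
        (Nat.card (IsLocalRing.ResidueField (w.adicCompletionIntegers K)) : ℤ) • y := by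
  have hq : residueFieldCard (w.adicCompletion K) = Nat.card (𝓞 K ⧸ w.asIdeal) := by
    rw [residueFieldCard_adicCompletion_eq K w, HeightOneSpectrum.residueCard_eq_card_quotient]
  have hσ : IsArithFrobAt (𝓞 K) (absGaloisRestrict K (w.adicCompletion K) φ)
      (adicCompletionPrime K w) :=
    (isArithFrobAt_absGaloisRestrict_adicCompletionPrime_iff K w hq φ).mpr
      (isFrobPow_one_iff_isAbsArithFrob_holds.mp hφ)
  exact primaryTorsionGaloisRep_sq_eq_of_isArithFrobAt hpw hv (adicCompletionPrime_mem_primesAbove K w)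
    hσ y

/-- **An arithmetic Frobenius lift exists in `Γ_{K_w}`** (re-export of the tree's discharged
`exists_isAbsArithFrob_holds` in `IsFrobPow` form, for the consumer's convenience).
[cite: NeukirchSchmidtWingberg2008, Thm. 7.5.3] -/
theorem exists_isFrobPow_one_adicCompletion (w : HeightOneSpectrum (𝓞 K)) :
    ∃ φ : absoluteGaloisGroup (w.adicCompletion K), IsFrobPow φ 1 := by
  obtain ⟨φ, hφ⟩ := exists_isAbsArithFrob_holds (F := w.adicCompletion K)
  exact ⟨φ, IsAbsArithFrob.isFrobPow_holds hφ⟩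

end CayleyHamilton

end WeierstrassCurve

end
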